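import Mathlib
import Summits.Ventures.PercRepro2.TwoTypedBridge

/-!
# Two typed edges: the typed bases of `K₃` with `|F| = 2` are nonnegative (blind cell PercRepro2,
night-3, 2026-08-24)

Row 2′TRI for two typed edges, kernel-checked: `typedCount {e₁, e₂} z τ K₃ ≥ 0` for every finite
graph, every marking (degenerate allowed), every pinned configuration `z` and both types on each
edge (`typedCount_pair_K3_nonneg`); hence `TypedBases` restricted to `|F| ≤ 2`
(`typedCount_nonneg_of_card_le_two`) and the weighted corollary `Gc_nonneg_of_fractional_le_two`:
(HCOV) `0 ≤ Gc = D · P(Q) · G` holds for every weight vector with AT MOST TWO fractional edges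
(`ZDelta_of_fractional_le_two`: the crux of record for those weight vectors).

Proof of `typedCount_pair_K3_nonneg`: `typedCount_pair` expands the count into the nine kernel
values on the square `z₀, z₀ + e₁, z₀ + e₂, z₀ + e₁ + e₂`; `K3_eq_KB` turns them into the state
kernel; the four states are `stL` of the least-representative labelling of the nine points and its
merges (`st_eq_stL`, `conn_update_lab`); the labelling is canonical, so `ok_of_canon` + `allOk_true`
give `ok`, i.e. the four offset table sums are `≥ 6`; `lk1_eq` / `lk2_eq` turn them into
`3K^sym + 6K^sym ≥ 0`, which is the expanded count.  Restricted three-copy reduction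
`triSum_nonneg_of_typedCount_subset` (the induction of `triSum_nonneg_of_pinned` with `F ⊆ S`).
-/

namespace Summit.Ventures.PercRepro2

open UnionCluster

namespace CovForm

namespace TwoTyped

open OneTyped

/-! ## The theorem -/

section Main

open Classical

variable {V : Type*} {E : Type*} [Fintype E] [DecidableEq E] {R : Type*} [Field R]
  [LinearOrder R] [IsStrictOrderedRing R]
variable (ends : E → Sym2 V) (o a₁ a₂ a₃ b : V)

/-- **Two typed edges never contribute negatively**: for the kernel `K₃`, the typed three-copy
count with two typed edges is nonnegative, for every pinned configuration and all four type pairs. -/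
theorem typedCount_pair_K3_nonneg (e₁ e₂ : E) (hne : e₁ ≠ e₂) (z : Config E) (τ : E → ℕ)
    (h₁ : τ e₁ = 1 ∨ τ e₁ = 2) (h₂ : τ e₂ = 1 ∨ τ e₂ = 2) :
    0 ≤ typedCount {e₁, e₂} z τ (K3 ends o a₁ a₂ a₃ b : Config E → Config E → Config E → R) := by
  obtain ⟨⟨u₁, w₁⟩, hu₁⟩ := Quot.exists_rep (ends e₁)
  obtain ⟨⟨u₂, w₂⟩, hu₂⟩ := Quot.exists_rep (ends e₂)
  have hends₁ : ends e₁ = s(u₁, w₁) := hu₁.symm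
  have hends₂ : ends e₂ = s(u₂, w₂) := hu₂.symm
  rw [typedCount_pair z e₁ e₂ hne]
  simp only [Fintype.sum_bool, Bool.toNat_true, Bool.toNat_false]
  set z00 := Function.update (Function.update z e₁ false) e₂ false with hz00
  set z10 := Function.update (Function.update z e₁ true) e₂ false with hz10
  set z01 := Function.update (Function.update z e₁ false) e₂ true with hz01
  set z11 := Function.update (Function.update z e₁ true) e₂ true with hz11
  have e10 : z10 = Function.update z00 e₁ true := by
    rw [hz10, hz00, Function.update_comm hne.symm, Function.update_idem]
  have e01 : z01 = Function.update z00 e₂ true := by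
    rw [hz01, hz00, Function.update_idem]
  have e11 : z11 = Function.update z10 e₂ true := by
    rw [hz11, hz10, Function.update_idem]
  -- the least-representative labelling of the nine points in `z00` and its three merges
  set f := lab ends o a₁ a₂ a₃ b [u₁, w₁, u₂, w₂] z00
  have hf : ∀ p q, f p = f q ↔ Conn ends z00 (pt o a₁ a₂ a₃ b [u₁, w₁, u₂, w₂] p)
      (pt o a₁ a₂ a₃ b [u₁, w₁, u₂, w₂] q) :=
    fun p q => lab_eq_iff ends o a₁ a₂ a₃ b [u₁, w₁, u₂, w₂] z00 p q
  have hf0 : f 0 = 0 := lab_zero ends o a₁ a₂ a₃ b [u₁, w₁, u₂, w₂] z00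
  have hle : ∀ i, f i ≤ i := lab_le ends o a₁ a₂ a₃ b [u₁, w₁, u₂, w₂] z00
  have hid : ∀ i, f (f i) = f i := lab_idem ends o a₁ a₂ a₃ b [u₁, w₁, u₂, w₂] z00
  have hg : ∀ p q, mrg (f 5) (f 6) (f p) = mrg (f 5) (f 6) (f q) ↔
      Conn ends z10 (pt o a₁ a₂ a₃ b [u₁, w₁, u₂, w₂] p) (pt o a₁ a₂ a₃ b [u₁, w₁, u₂, w₂] q) := by
    intro p q
    rw [e10]
    exact conn_update_lab ends o a₁ a₂ a₃ b [u₁, w₁, u₂, w₂] z00 f hf (i := 5) (j := 6) hends₁ p q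
  have hh : ∀ p q, mrg (f 7) (f 8) (f p) = mrg (f 7) (f 8) (f q) ↔
      Conn ends z01 (pt o a₁ a₂ a₃ b [u₁, w₁, u₂, w₂] p) (pt o a₁ a₂ a₃ b [u₁, w₁, u₂, w₂] q) := by
    intro p q
    rw [e01]
    exact conn_update_lab ends o a₁ a₂ a₃ b [u₁, w₁, u₂, w₂] z00 f hf (i := 7) (j := 8) hends₂ p q
  have hk : ∀ p q,
      mrg (mrg (f 5) (f 6) (f 7)) (mrg (f 5) (f 6) (f 8)) (mrg (f 5) (f 6) (f p)) =
        mrg (mrg (f 5) (f 6) (f 7)) (mrg (f 5) (f 6) (f 8)) (mrg (f 5) (f 6) (f q)) ↔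
      Conn ends z11 (pt o a₁ a₂ a₃ b [u₁, w₁, u₂, w₂] p) (pt o a₁ a₂ a₃ b [u₁, w₁, u₂, w₂] q) := by
    intro p q
    rw [e11]
    exact conn_update_lab ends o a₁ a₂ a₃ b [u₁, w₁, u₂, w₂] z10 (fun p => mrg (f 5) (f 6) (f p))
      hg (i := 7) (j := 8) hends₂ p q
  -- the four states through the labels
  have hA := st_eq_stL ends o a₁ a₂ a₃ b [u₁, w₁, u₂, w₂] z00 f hf
  have hB := st_eq_stL ends o a₁ a₂ a₃ b [u₁, w₁, u₂, w₂] z10 (fun p => mrg (f 5) (f 6) (f p)) hg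
  have hC := st_eq_stL ends o a₁ a₂ a₃ b [u₁, w₁, u₂, w₂] z01 (fun p => mrg (f 7) (f 8) (f p)) hh
  have hD := st_eq_stL ends o a₁ a₂ a₃ b [u₁, w₁, u₂, w₂] z11
    (fun p => mrg (mrg (f 5) (f 6) (f 7)) (mrg (f 5) (f 6) (f 8)) (mrg (f 5) (f 6) (f p))) hk
  simp only [hf0] at hA hB hC hD
  -- the labelling is canonical, so it is one of the enumerated ones
  have c1 : f 1 = 1 ∨ f 1 = 0 := by
    rcases canon_cases f 1 (hle 1) (hid 1) with h | ⟨k, hk, hk1, -⟩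
    · simp [h]
    · interval_cases k
      simp [hk1]
  have c2 : f 2 = 2 ∨ f 2 = 0 ∨ (f 2 = 1 ∧ f 1 = 1) := by
    rcases canon_cases f 2 (hle 2) (hid 2) with h | ⟨k, hk, hk1, hk2⟩
    · simp [h]
    · interval_cases k <;> simp [hk1, hk2]
  have c3 : f 3 = 3 ∨ f 3 = 0 ∨ (f 3 = 1 ∧ f 1 = 1) ∨ (f 3 = 2 ∧ f 2 = 2) := by
    rcases canon_cases f 3 (hle 3) (hid 3) with h | ⟨k, hk, hk1, hk2⟩
    · simp [h]
    · interval_cases k <;> simp [hk1, hk2]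
  have c4 : f 4 = 4 ∨ f 4 = 0 ∨ (f 4 = 1 ∧ f 1 = 1) ∨ (f 4 = 2 ∧ f 2 = 2) ∨ (f 4 = 3 ∧ f 3 = 3) := by
    rcases canon_cases f 4 (hle 4) (hid 4) with h | ⟨k, hk, hk1, hk2⟩
    · simp [h]
    · interval_cases k <;> simp [hk1, hk2]
  have c5 : f 5 = 5 ∨ f 5 = 0 ∨ (f 5 = 1 ∧ f 1 = 1) ∨ (f 5 = 2 ∧ f 2 = 2) ∨ (f 5 = 3 ∧ f 3 = 3) ∨ (f 5 = 4 ∧ f 4 = 4) := by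
    rcases canon_cases f 5 (hle 5) (hid 5) with h | ⟨k, hk, hk1, hk2⟩
    · simp [h]
    · interval_cases k <;> simp [hk1, hk2]
  have c6 : f 6 = 6 ∨ f 6 = 0 ∨ (f 6 = 1 ∧ f 1 = 1) ∨ (f 6 = 2 ∧ f 2 = 2) ∨ (f 6 = 3 ∧ f 3 = 3) ∨ (f 6 = 4 ∧ f 4 = 4) ∨ (f 6 = 5 ∧ f 5 = 5) := by
    rcases canon_cases f 6 (hle 6) (hid 6) with h | ⟨k, hk, hk1, hk2⟩
    · simp [h]
    · interval_cases k <;> simp [hk1, hk2]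
  have c7 : f 7 = 7 ∨ f 7 = 0 ∨ (f 7 = 1 ∧ f 1 = 1) ∨ (f 7 = 2 ∧ f 2 = 2) ∨ (f 7 = 3 ∧ f 3 = 3) ∨ (f 7 = 4 ∧ f 4 = 4) ∨ (f 7 = 5 ∧ f 5 = 5) ∨ (f 7 = 6 ∧ f 6 = 6) := by
    rcases canon_cases f 7 (hle 7) (hid 7) with h | ⟨k, hk, hk1, hk2⟩
    · simp [h]
    · interval_cases k <;> simp [hk1, hk2]
  have c8 : f 8 = 8 ∨ f 8 = 0 ∨ (f 8 = 1 ∧ f 1 = 1) ∨ (f 8 = 2 ∧ f 2 = 2) ∨ (f 8 = 3 ∧ f 3 = 3) ∨ (f 8 = 4 ∧ f 4 = 4) ∨ (f 8 = 5 ∧ f 5 = 5) ∨ (f 8 = 6 ∧ f 6 = 6) ∨ (f 8 = 7 ∧ f 7 = 7) := by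
    rcases canon_cases f 8 (hle 8) (hid 8) with h | ⟨k, hk, hk1, hk2⟩
    · simp [h]
    · interval_cases k <;> simp [hk1, hk2]
  have hok := ok_of_canon (f 1) (f 2) (f 3) (f 4) (f 5) (f 6) (f 7) (f 8) (hle 1) (hle 2) (hle 3)
    (hle 4) (hle 5) (hle 6) (hle 7) (hle 8) c1 c2 c3 c4 c5 c6 c7 c8
  by_cases hq : f 1 = 0
  · -- `Q` fails in `z00`, hence in all four configurations: every kernel value vanishes
    have hQ00 : Conn ends z00 a₂ a₁ := (hf 1 0).mp (by rw [hq, hf0])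
    have hQ10 : Conn ends z10 a₂ a₁ := by
      rw [e10]; exact conn_mono (OneEdge.le_update_true _ _) hQ00
    have hQ01 : Conn ends z01 a₂ a₁ := by
      rw [e01]; exact conn_mono (OneEdge.le_update_true _ _) hQ00
    have hQ11 : Conn ends z11 a₂ a₁ := by
      rw [e11]; exact conn_mono (OneEdge.le_update_true _ _) hQ10
    rcases h₁ with h | h <;> rcases h₂ with h' | h' <;> simp only [h, h'] <;> norm_num <;>
      simp [K3_zero_x ends o a₁ a₂ a₃ b hQ00, K3_zero_x ends o a₁ a₂ a₃ b hQ10,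
        K3_zero_x ends o a₁ a₂ a₃ b hQ01, K3_zero_x ends o a₁ a₂ a₃ b hQ11]
  · simp only [ok, if_neg hq] at hok
    rw [← hA, ← hB, ← hC, ← hD] at hok
    have vA := valid_st ends o a₁ a₂ a₃ b z00
    have vB := valid_st ends o a₁ a₂ a₃ b z10
    have vC := valid_st ends o a₁ a₂ a₃ b z01
    have vD := valid_st ends o a₁ a₂ a₃ b z11
    simp only [ok4, Bool.and_eq_true, Nat.ble_eq] at hok
    obtain ⟨⟨⟨k11, k12⟩, k21⟩, k22⟩ := hok
    have l11a := lk1_eq _ _ vD vA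
    have l11b := lk2_eq _ _ _ vB vC vA
    have l12a := lk1_eq _ _ vB vC
    have l12b := lk2_eq _ _ _ vD vA vC
    have l21a := lk1_eq _ _ vC vB
    have l21b := lk2_eq _ _ _ vA vD vB
    have l22a := lk1_eq _ _ vA vD
    have l22b := lk2_eq _ _ _ vC vB vD
    have i11 : (0 : ℤ) ≤ T1 (st ends o a₁ a₂ a₃ b z11) (st ends o a₁ a₂ a₃ b z00) + T2 (st ends o a₁ a₂ a₃ b z10) (st ends o a₁ a₂ a₃ b z01) (st ends o a₁ a₂ a₃ b z00) := by omega
    have i12 : (0 : ℤ) ≤ T1 (st ends o a₁ a₂ a₃ b z10) (st ends o a₁ a₂ a₃ b z01) + T2 (st ends o a₁ a₂ a₃ b z11) (st ends o a₁ a₂ a₃ b z00) (st ends o a₁ a₂ a₃ b z01) := by omega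
    have i21 : (0 : ℤ) ≤ T1 (st ends o a₁ a₂ a₃ b z01) (st ends o a₁ a₂ a₃ b z10) + T2 (st ends o a₁ a₂ a₃ b z00) (st ends o a₁ a₂ a₃ b z11) (st ends o a₁ a₂ a₃ b z10) := by omega
    have i22 : (0 : ℤ) ≤ T1 (st ends o a₁ a₂ a₃ b z00) (st ends o a₁ a₂ a₃ b z11) + T2 (st ends o a₁ a₂ a₃ b z01) (st ends o a₁ a₂ a₃ b z10) (st ends o a₁ a₂ a₃ b z11) := by omega
    have c11 : (0 : R) ≤ ((T1 (st ends o a₁ a₂ a₃ b z11) (st ends o a₁ a₂ a₃ b z00) + T2 (st ends o a₁ a₂ a₃ b z10) (st ends o a₁ a₂ a₃ b z01) (st ends o a₁ a₂ a₃ b z00) : ℤ) : R) := by exact_mod_cast i11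
    have c12 : (0 : R) ≤ ((T1 (st ends o a₁ a₂ a₃ b z10) (st ends o a₁ a₂ a₃ b z01) + T2 (st ends o a₁ a₂ a₃ b z11) (st ends o a₁ a₂ a₃ b z00) (st ends o a₁ a₂ a₃ b z01) : ℤ) : R) := by exact_mod_cast i12
    have c21 : (0 : R) ≤ ((T1 (st ends o a₁ a₂ a₃ b z01) (st ends o a₁ a₂ a₃ b z10) + T2 (st ends o a₁ a₂ a₃ b z00) (st ends o a₁ a₂ a₃ b z11) (st ends o a₁ a₂ a₃ b z10) : ℤ) : R) := by exact_mod_cast i21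
    have c22 : (0 : R) ≤ ((T1 (st ends o a₁ a₂ a₃ b z00) (st ends o a₁ a₂ a₃ b z11) + T2 (st ends o a₁ a₂ a₃ b z01) (st ends o a₁ a₂ a₃ b z10) (st ends o a₁ a₂ a₃ b z11) : ℤ) : R) := by exact_mod_cast i22
    simp only [T1, T2] at c11 c12 c21 c22
    push_cast at c11 c12 c21 c22
    rcases h₁ with h | h <;> rcases h₂ with h' | h' <;> simp only [h, h'] <;> norm_num <;>
      simp only [K3_eq_KB ends o a₁ a₂ a₃ b] <;> linarith

/-- **`TypedBases` for at most two typed edges**: every typed count of `K₃` with `|F| ≤ 2` and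
types in `{1, 2}` is nonnegative (`|F| = 0`: the diagonal vanishes; `|F| = 1`:
`typedCount_singleton_K3`; `|F| = 2`: `typedCount_pair_K3_nonneg`). -/
theorem typedCount_nonneg_of_card_le_two (F : Finset E) (hF : F.card ≤ 2) (z : Config E)
    (τ : E → ℕ) (hτ : ∀ e ∈ F, τ e = 1 ∨ τ e = 2) :
    0 ≤ typedCount F z τ (K3 ends o a₁ a₂ a₃ b : Config E → Config E → Config E → R) := by
  rcases Nat.lt_or_ge F.card 2 with h | h
  · rcases Nat.lt_or_ge F.card 1 with h0 | h1
    · have hF0 : F = ∅ := Finset.card_eq_zero.mp (by omega)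
      subst hF0
      simp only [typedCount_empty, K3_diag, le_refl]
    · obtain ⟨e, rfl⟩ := Finset.card_eq_one.mp (show F.card = 1 by omega)
      simp only [typedCount_singleton_K3 ends o a₁ a₂ a₃ b e z τ
        (hτ e (Finset.mem_singleton_self e)), le_refl]
  · obtain ⟨e₁, e₂, hne, rfl⟩ := Finset.card_eq_two.mp (show F.card = 2 by omega)
    exact typedCount_pair_K3_nonneg ends o a₁ a₂ a₃ b e₁ e₂ hne z τ
      (hτ e₁ (by simp)) (hτ e₂ (by simp))

end Main

/-! ## The weighted corollary: (HCOV) with at most two fractional edges -/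

section Weighted

variable {E : Type*} [Fintype E] [DecidableEq E] {R : Type*} [Field R] [LinearOrder R]
  [IsStrictOrderedRing R]

/-- **Restricted three-copy reduction**: if the typed counts are nonnegative on the subsets of
`S`, the typed sums are nonnegative for every weight vector pinned off `S` (the induction of
`triSum_nonneg_of_pinned`, with the invariant `F ⊆ S`). -/
theorem triSum_nonneg_of_typedCount_subset (K : Config E → Config E → Config E → R)
    (S : Finset E)
    (hcount : ∀ G : Finset E, G ⊆ S → ∀ (z : Config E) (σ : E → ℕ),
      (∀ e ∈ G, σ e = 1 ∨ σ e = 2) → 0 ≤ typedCount G z σ K)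
    (p : E → R) (hp : ∀ e, 0 ≤ p e ∧ p e ≤ 1) (hS : ∀ e, e ∉ S → p e = 0 ∨ p e = 1)
    (F : Finset E) (hF : F ⊆ S) (τ : E → ℕ) (hτ : ∀ e ∈ F, τ e = 1 ∨ τ e = 2) :
    0 ≤ triSum p F τ K := by
  generalize hn : (triFracFree p F).card = n
  induction n using Nat.strong_induction_on generalizing p F τ with
  | _ n ih =>
    by_cases h0 : triFracFree p F = ∅
    · have hpin : ∀ e, e ∉ F → p e = 0 ∨ p e = 1 := by
        intro e he
        by_contra hc
        rw [not_or] at hc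
        have : e ∈ triFracFree p F := mem_triFracFree.mpr ⟨he, hc.1, hc.2⟩
        rw [h0] at this
        exact absurd this (Finset.notMem_empty e)
      rw [triSum_pinned_eq p F hpin τ K]
      exact mul_nonneg (prod_typed_factors_nonneg p hp F τ) (hcount F hF _ τ hτ)
    · obtain ⟨e, he⟩ := Finset.nonempty_iff_ne_empty.mpr h0
      have heF : e ∉ F := (mem_triFracFree.mp he).1
      have heS : e ∈ S := by
        by_contra hc
        rcases hS e hc with h | h
        · exact (mem_triFracFree.mp he).2.1 h
        · exact (mem_triFracFree.mp he).2.2 h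
      have hlt : ((triFracFree p F).erase e).card < n := by
        rw [← hn]
        exact Finset.card_erase_lt_of_mem he
      have hp0 : ∀ e', 0 ≤ Function.update p e 0 e' ∧ Function.update p e 0 e' ≤ 1 := by
        intro e'
        by_cases h : e' = e
        · subst h; simp
        · rw [Function.update_of_ne h]; exact hp e'
      have hp1 : ∀ e', 0 ≤ Function.update p e 1 e' ∧ Function.update p e 1 e' ≤ 1 := by
        intro e'
        by_cases h : e' = e
        · subst h; simp
        · rw [Function.update_of_ne h]; exact hp e'
      have hS0 : ∀ e', e' ∉ S → Function.update p e 0 e' = 0 ∨ Function.update p e 0 e' = 1 := by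
        intro e' he'
        by_cases h : e' = e
        · subst h; simp
        · rw [Function.update_of_ne h]; exact hS e' he'
      have hS1 : ∀ e', e' ∉ S → Function.update p e 1 e' = 0 ∨ Function.update p e 1 e' = 1 := by
        intro e' he'
        by_cases h : e' = e
        · subst h; simp
        · rw [Function.update_of_ne h]; exact hS e' he'
      have hτ1 : ∀ e' ∈ insert e F, Function.update τ e 1 e' = 1 ∨ Function.update τ e 1 e' = 2 := by
        intro e' he'
        by_cases h : e' = e
        · subst h; simp
        · rw [Function.update_of_ne h]
          exact hτ e' (Finset.mem_of_mem_insert_of_ne he' h)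
      have hτ2 : ∀ e' ∈ insert e F, Function.update τ e 2 e' = 1 ∨ Function.update τ e 2 e' = 2 := by
        intro e' he'
        by_cases h : e' = e
        · subst h; simp
        · rw [Function.update_of_ne h]
          exact hτ e' (Finset.mem_of_mem_insert_of_ne he' h)
      have hF' : insert e F ⊆ S := Finset.insert_subset heS hF
      have hc0 : (triFracFree (Function.update p e 0) F).card = ((triFracFree p F).erase e).card := by
        rw [triFracFree_update p F e 0 (Or.inl rfl)]
      have hc1 : (triFracFree (Function.update p e 1) F).card = ((triFracFree p F).erase e).card := by
        rw [triFracFree_update p F e 1 (Or.inr rfl)]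
      have hc2 : (triFracFree p (insert e F)).card = ((triFracFree p F).erase e).card := by
        rw [triFracFree_insert]
      have h1 : 0 ≤ triSum (Function.update p e 0) F τ K := ih _ hlt _ hp0 hS0 F hF τ hτ hc0
      have h2 : 0 ≤ triSum (Function.update p e 1) F τ K := ih _ hlt _ hp1 hS1 F hF τ hτ hc1
      have h3 : 0 ≤ triSum p (insert e F) (Function.update τ e 1) K :=
        ih _ hlt _ hp hS (insert e F) hF' _ hτ1 hc2
      have h4 : 0 ≤ triSum p (insert e F) (Function.update τ e 2) K :=
        ih _ hlt _ hp hS (insert e F) hF' _ hτ2 hc2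
      rw [triSum_pin p heF τ K]
      have hpe := hp e
      have h1' : 0 ≤ (1 - p e) ^ 3 := by
        have : 0 ≤ 1 - p e := sub_nonneg.mpr hpe.2
        positivity
      have h2' : 0 ≤ (p e) ^ 3 := by
        have := hpe.1
        positivity
      have := mul_nonneg h1' h1
      have := mul_nonneg h2' h2
      linarith

variable {V : Type*} (ends : E → Sym2 V) (o a₁ a₂ a₃ b : V)

/-- **(HCOV) with at most two fractional edges**: `0 ≤ Gc = D · P(Q) · G` for every weight vector
with at most two edges of weight strictly between `0` and `1` (one such edge: `Gc = 0`,
`Gc_eq_zero_of_one_fractional`). -/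
theorem Gc_nonneg_of_fractional_le_two (p : E → R) (hp : IsProbVec p)
    (hfrac : (Finset.univ.filter fun e => p e ≠ 0 ∧ p e ≠ 1).card ≤ 2) :
    0 ≤ Gc p ends o a₁ a₂ a₃ b := by
  rw [hcov_cubic p ends o a₁ a₂ a₃ b (fun _ => 0)]
  refine triSum_nonneg_of_typedCount_subset (K3 ends o a₁ a₂ a₃ b)
    (Finset.univ.filter fun e => p e ≠ 0 ∧ p e ≠ 1) ?_ p (fun e => ⟨hp.nonneg e, hp.le_one e⟩) ?_ ∅
    (Finset.empty_subset _) (fun _ => 0) (fun e he => absurd he (Finset.notMem_empty e))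
  · intro G hG z σ hσ
    exact typedCount_nonneg_of_card_le_two ends o a₁ a₂ a₃ b G
      (le_trans (Finset.card_le_card hG) hfrac) z σ hσ
  · intro e he
    simp only [Finset.mem_filter, Finset.mem_univ, true_and, not_and, not_not] at he
    by_cases h : p e = 0
    · exact Or.inl h
    · exact Or.inr (he h)

/-- **The crux of record with at most two fractional edges**: `ZDelta` for every labelled instance
whose weight vector has at most two fractional edges (`ZDelta_of_HCov`). -/
theorem ZDelta_of_fractional_le_two [Fintype V] [DecidableEq V] (p : E → R) (hp : IsProbVec p)
    (hfrac : (Finset.univ.filter fun e => p e ≠ 0 ∧ p e ≠ 1).card ≤ 2)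
    (hord : prob p (connEvent ends a₁ b) ≤ prob p (connEvent ends a₂ b)) :
    ZDelta p ends o a₁ a₂ a₃ b :=
  ZDelta_of_HCov p hp ends hord (Gc_nonneg_of_fractional_le_two ends o a₁ a₂ a₃ b p hp hfrac)

end Weighted

end TwoTyped

end CovForm

end Summit.Ventures.PercRepro2
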